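import Literature.Analysis.OperatorTheory.SchurTestKernel
import HarnessLib

/-!
# C4 INNER, brick D0: pointwise two-sided kernel comparison ⇒ comparison of SIGNED quadratic forms
# (lane A of S-BASE, crux `TwistedTraceScaling` stmt-QuantumFields-20203; sub-target C4, design note `pub/ym-fleet/ym-luscher-20007-p1/COARSE-DESIGN.md` §21.3, §21.5 D)

The diagonal block of the Born–Oppenheimer package compares the projected lattice kernel `K_eff(c,c')` with the one-site kernel `σ·K₁(c,c')`.  Pointwise kernel
bounds control `⟨|f|, K |f|⟩`, not signed Rayleigh quotients — EXCEPT when they are TWO-SIDED and RELATIVE: if `|K₂ − s·K₁| ≤ η·s·K₁` pointwise with `K₁ ≥ 0`, then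
for every signed `f`: `|⟨f,K₂f⟩ − s⟨f,K₁f⟩| ≤ η·s·⟨|f|,K₁|f|⟩ ≤ η·s·M₁·‖f‖²` (Schur, row sums of `K₁` at most `M₁`).  With `η = O(β^{−1/2}·polylog) = o(λ_b)` (§21.2)
this transfers the one-site min–max levels to `K_eff` at the precision the package needs.  General s-finite measure space; the product-integrability of
`|f| K₁ |f|` is assumed (as in `Literature.Analysis.OperatorTheory.SchurTestKernel`), that of `f K₂ f` is derived.
* ★ `abs_form_sub_le_of_kernel_near` — the form comparison; ★ `form_le_of_kernel_near` / `form_ge_of_kernel_near` — the one-sided consequences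
  `⟨f,K₂f⟩ ≤ s(⟨f,K₁f⟩ + ηM₁‖f‖²)`, `s(⟨f,K₁f⟩ − ηM₁‖f‖²) ≤ ⟨f,K₂f⟩`;
* ★ `abs_bilin_sub_le_of_kernel_near` — the bilinear version `|⟨u,K₂v⟩ − s⟨u,K₁v⟩| ≤ ηsM₁‖u‖‖v‖` (the OFF-DIAGONAL size `b` of the package).
HONEST FRAMING: elementary measure theory for a stub of a child of the CONDITIONAL reduction route (femto rung R2b1); not infinite volume, not a gap, not Clay.

## References
* B. Helffer, *Spectral Theory and its Applications*, CUP 2013, Lemma 7.1 (Schur's test). [Helffer2013]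
-/

set_option autoImplicit false

open MeasureTheory

namespace Summit.QuantumFields.YangMills.Theorems.FemtoTransferGap.KernelComparison

open Literature.Analysis.OperatorTheory

variable {X : Type*} [MeasurableSpace X] {μ : Measure X} [SFinite μ]

omit [MeasurableSpace X] in
/-- Pointwise: `|f(x) (K₂ − sK₁)(x,y) f(y)| ≤ η s · |f(x)| K₁(x,y) |f(y)|`. [folklore] -/
theorem abs_mul_sub_mul_le {K₁ K₂ : X → X → ℝ} {s η : ℝ} (hnear : ∀ x y, |K₂ x y - s * K₁ x y| ≤ η * s * K₁ x y)
    (f : X → ℝ) (x y : X) :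
    |f x * K₂ x y * f y - s * (f x * K₁ x y * f y)| ≤ η * s * (|f x| * K₁ x y * |f y|) := by
  have e : f x * K₂ x y * f y - s * (f x * K₁ x y * f y) = f x * (K₂ x y - s * K₁ x y) * f y := by ring
  rw [e, abs_mul, abs_mul]
  have h := hnear x y
  have hK : 0 ≤ η * s * K₁ x y := le_trans (abs_nonneg _) h
  calc |f x| * |K₂ x y - s * K₁ x y| * |f y| ≤ |f x| * (η * s * K₁ x y) * |f y| :=
        mul_le_mul_of_nonneg_right (mul_le_mul_of_nonneg_left h (abs_nonneg _)) (abs_nonneg _)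
    _ = η * s * (|f x| * K₁ x y * |f y|) := by ring

omit [SFinite μ] in
/-- The `K₂` integrand is product-integrable when the `|f| K₁ |f|` one is. [folklore] -/
theorem integrable_mul_kernel_mul_of_near {K₁ K₂ : X → X → ℝ} {s η : ℝ} (hs : 0 ≤ s) (hK₁ : ∀ x y, 0 ≤ K₁ x y)
    (hnear : ∀ x y, |K₂ x y - s * K₁ x y| ≤ η * s * K₁ x y) {f : X → ℝ}
    (hmeas : AEStronglyMeasurable (fun p : X × X => f p.1 * K₂ p.1 p.2 * f p.2) (μ.prod μ))
    (hI : Integrable (fun p : X × X => |f p.1| * K₁ p.1 p.2 * |f p.2|) (μ.prod μ)) :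
    Integrable (fun p : X × X => f p.1 * K₂ p.1 p.2 * f p.2) (μ.prod μ) := by
  refine (hI.const_mul ((1 + η) * s)).mono' hmeas (ae_of_all _ fun p => ?_)
  have h1 := abs_mul_sub_mul_le hnear f p.1 p.2
  have h2 : |s * (f p.1 * K₁ p.1 p.2 * f p.2)| = s * (|f p.1| * K₁ p.1 p.2 * |f p.2|) := by
    rw [abs_mul, abs_of_nonneg hs, abs_mul, abs_mul, abs_of_nonneg (hK₁ _ _)]
  rw [Real.norm_eq_abs]
  have := abs_sub_abs_le_abs_sub (f p.1 * K₂ p.1 p.2 * f p.2) (s * (f p.1 * K₁ p.1 p.2 * f p.2))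
  rw [h2] at this
  nlinarith

/-- ★ **Two-sided relative kernel comparison ⇒ signed form comparison**: if `K₁ ≥ 0` is symmetric with row integrals `≤ M₁` and
`|K₂ − s K₁| ≤ η s K₁` pointwise (`s, η ≥ 0`), then for every `f` with `f²` integrable (and `|f|K₁|f|` product-integrable):
`|∫∫ f K₂ f − s ∫∫ f K₁ f| ≤ η·s·M₁·∫ f²`. [cite: Helffer2013, Lemma 7.1] -/
theorem abs_form_sub_le_of_kernel_near {K₁ K₂ : X → X → ℝ} {s η M₁ : ℝ} (hs : 0 ≤ s) (hη : 0 ≤ η) (hK₁ : ∀ x y, 0 ≤ K₁ x y)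
    (hsymm : ∀ x y, K₁ x y = K₁ y x) (hrow : ∀ᵐ x ∂μ, ∫ y, K₁ x y ∂μ ≤ M₁)
    (hnear : ∀ x y, |K₂ x y - s * K₁ x y| ≤ η * s * K₁ x y) {f : X → ℝ} (hf : Integrable (fun x => f x ^ 2) μ)
    (hmeas : AEStronglyMeasurable (fun p : X × X => f p.1 * K₂ p.1 p.2 * f p.2) (μ.prod μ))
    (hI : Integrable (fun p : X × X => |f p.1| * K₁ p.1 p.2 * |f p.2|) (μ.prod μ))
    (hIs : Integrable (fun p : X × X => f p.1 * K₁ p.1 p.2 * f p.2) (μ.prod μ))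
    (hI₁ : Integrable (fun p : X × X => K₁ p.1 p.2 * f p.1 ^ 2) (μ.prod μ))
    (hI₂ : Integrable (fun p : X × X => K₁ p.1 p.2 * f p.2 ^ 2) (μ.prod μ)) :
    |(∫ x, ∫ y, f x * K₂ x y * f y ∂μ ∂μ) - s * ∫ x, ∫ y, f x * K₁ x y * f y ∂μ ∂μ| ≤ η * s * M₁ * ∫ x, f x ^ 2 ∂μ := by
  have hI2 := integrable_mul_kernel_mul_of_near hs hK₁ hnear hmeas hI
  -- pass to the product measure
  rw [← integral_prod _ hI2, ← integral_prod _ hIs, ← integral_const_mul, ← integral_sub hI2 (hIs.const_mul s)]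
  -- pointwise bound, then Schur for `|f|`
  have hpt : ∀ p : X × X, ‖f p.1 * K₂ p.1 p.2 * f p.2 - s * (f p.1 * K₁ p.1 p.2 * f p.2)‖ ≤ η * s * (|f p.1| * K₁ p.1 p.2 * |f p.2|) := fun p => by
    rw [Real.norm_eq_abs]; exact abs_mul_sub_mul_le hnear f p.1 p.2
  rw [← Real.norm_eq_abs]
  refine (norm_integral_le_of_norm_le (hI.const_mul (η * s)) (ae_of_all _ hpt)).trans ?_
  rw [integral_const_mul, integral_prod _ hI]
  have hgoal : ∫ x, ∫ y, |f x| * K₁ x y * |f y| ∂μ ∂μ ≤ M₁ * ∫ x, f x ^ 2 ∂μ := ?_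
  · have := mul_le_mul_of_nonneg_left hgoal (mul_nonneg hη hs)
    simpa [mul_assoc] using this
  -- Schur on `|f|`
  have habs2 : Integrable (fun x => |f x| ^ 2) μ := hf.congr (ae_of_all _ fun x => (sq_abs (f x)).symm)
  have h := SchurTest.integral_integral_mul_kernel_mul_self_le_of_symm (μ := μ) K₁ (fun x => |f x|) hK₁ hsymm hrow habs2 hI
    (hI₁.congr (ae_of_all _ fun p => by simp only [sq_abs])) (hI₂.congr (ae_of_all _ fun p => by simp only [sq_abs]))
  simp only [sq_abs] at h
  exact h

/-- ★ One-sided consequence (UPPER): `⟨f,K₂f⟩ ≤ s·(⟨f,K₁f⟩ + η M₁ ‖f‖²)`. [cite: Helffer2013, Lemma 7.1] -/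
theorem form_le_of_kernel_near {K₁ K₂ : X → X → ℝ} {s η M₁ : ℝ} (hs : 0 ≤ s) (hη : 0 ≤ η) (hK₁ : ∀ x y, 0 ≤ K₁ x y)
    (hsymm : ∀ x y, K₁ x y = K₁ y x) (hrow : ∀ᵐ x ∂μ, ∫ y, K₁ x y ∂μ ≤ M₁)
    (hnear : ∀ x y, |K₂ x y - s * K₁ x y| ≤ η * s * K₁ x y) {f : X → ℝ} (hf : Integrable (fun x => f x ^ 2) μ)
    (hmeas : AEStronglyMeasurable (fun p : X × X => f p.1 * K₂ p.1 p.2 * f p.2) (μ.prod μ))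
    (hI : Integrable (fun p : X × X => |f p.1| * K₁ p.1 p.2 * |f p.2|) (μ.prod μ))
    (hIs : Integrable (fun p : X × X => f p.1 * K₁ p.1 p.2 * f p.2) (μ.prod μ))
    (hI₁ : Integrable (fun p : X × X => K₁ p.1 p.2 * f p.1 ^ 2) (μ.prod μ))
    (hI₂ : Integrable (fun p : X × X => K₁ p.1 p.2 * f p.2 ^ 2) (μ.prod μ)) :
    ∫ x, ∫ y, f x * K₂ x y * f y ∂μ ∂μ ≤ s * ((∫ x, ∫ y, f x * K₁ x y * f y ∂μ ∂μ) + η * M₁ * ∫ x, f x ^ 2 ∂μ) := by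
  have h := abs_le.mp (abs_form_sub_le_of_kernel_near hs hη hK₁ hsymm hrow hnear hf hmeas hI hIs hI₁ hI₂)
  nlinarith [h.2]

/-- ★ One-sided consequence (LOWER): `s·(⟨f,K₁f⟩ − η M₁ ‖f‖²) ≤ ⟨f,K₂f⟩`. [cite: Helffer2013, Lemma 7.1] -/
theorem form_ge_of_kernel_near {K₁ K₂ : X → X → ℝ} {s η M₁ : ℝ} (hs : 0 ≤ s) (hη : 0 ≤ η) (hK₁ : ∀ x y, 0 ≤ K₁ x y)
    (hsymm : ∀ x y, K₁ x y = K₁ y x) (hrow : ∀ᵐ x ∂μ, ∫ y, K₁ x y ∂μ ≤ M₁)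
    (hnear : ∀ x y, |K₂ x y - s * K₁ x y| ≤ η * s * K₁ x y) {f : X → ℝ} (hf : Integrable (fun x => f x ^ 2) μ)
    (hmeas : AEStronglyMeasurable (fun p : X × X => f p.1 * K₂ p.1 p.2 * f p.2) (μ.prod μ))
    (hI : Integrable (fun p : X × X => |f p.1| * K₁ p.1 p.2 * |f p.2|) (μ.prod μ))
    (hIs : Integrable (fun p : X × X => f p.1 * K₁ p.1 p.2 * f p.2) (μ.prod μ))
    (hI₁ : Integrable (fun p : X × X => K₁ p.1 p.2 * f p.1 ^ 2) (μ.prod μ))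
    (hI₂ : Integrable (fun p : X × X => K₁ p.1 p.2 * f p.2 ^ 2) (μ.prod μ)) :
    s * ((∫ x, ∫ y, f x * K₁ x y * f y ∂μ ∂μ) - η * M₁ * ∫ x, f x ^ 2 ∂μ) ≤ ∫ x, ∫ y, f x * K₂ x y * f y ∂μ ∂μ := by
  have h := abs_le.mp (abs_form_sub_le_of_kernel_near hs hη hK₁ hsymm hrow hnear hf hmeas hI hIs hI₁ hI₂)
  nlinarith [h.1]

/-! ## Bilinear version (the OFF-DIAGONAL block of the package) -/

omit [MeasurableSpace X] in
/-- Pointwise, two functions: `|u(x) (K₂ − sK₁)(x,y) v(y)| ≤ η s · |u(x)| K₁(x,y) |v(y)|`. [folklore] -/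
theorem abs_mul_sub_mul_le₂ {K₁ K₂ : X → X → ℝ} {s η : ℝ} (hnear : ∀ x y, |K₂ x y - s * K₁ x y| ≤ η * s * K₁ x y)
    (u v : X → ℝ) (x y : X) :
    |u x * K₂ x y * v y - s * (u x * K₁ x y * v y)| ≤ η * s * (|u x| * K₁ x y * |v y|) := by
  have e : u x * K₂ x y * v y - s * (u x * K₁ x y * v y) = u x * (K₂ x y - s * K₁ x y) * v y := by ring
  rw [e, abs_mul, abs_mul]
  have h := hnear x y
  calc |u x| * |K₂ x y - s * K₁ x y| * |v y| ≤ |u x| * (η * s * K₁ x y) * |v y| :=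
        mul_le_mul_of_nonneg_right (mul_le_mul_of_nonneg_left h (abs_nonneg _)) (abs_nonneg _)
    _ = η * s * (|u x| * K₁ x y * |v y|) := by ring

omit [SFinite μ] in
/-- The bilinear `K₂` integrand is product-integrable when the `|u| K₁ |v|` one is. [folklore] -/
theorem integrable_bilin_kernel_of_near {K₁ K₂ : X → X → ℝ} {s η : ℝ} (hs : 0 ≤ s) (hK₁ : ∀ x y, 0 ≤ K₁ x y)
    (hnear : ∀ x y, |K₂ x y - s * K₁ x y| ≤ η * s * K₁ x y) {u v : X → ℝ}
    (hmeas : AEStronglyMeasurable (fun p : X × X => u p.1 * K₂ p.1 p.2 * v p.2) (μ.prod μ))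
    (hI : Integrable (fun p : X × X => |u p.1| * K₁ p.1 p.2 * |v p.2|) (μ.prod μ)) :
    Integrable (fun p : X × X => u p.1 * K₂ p.1 p.2 * v p.2) (μ.prod μ) := by
  refine (hI.const_mul ((1 + η) * s)).mono' hmeas (ae_of_all _ fun p => ?_)
  have h1 := abs_mul_sub_mul_le₂ hnear u v p.1 p.2
  have h2 : |s * (u p.1 * K₁ p.1 p.2 * v p.2)| = s * (|u p.1| * K₁ p.1 p.2 * |v p.2|) := by
    rw [abs_mul, abs_of_nonneg hs, abs_mul, abs_mul, abs_of_nonneg (hK₁ _ _)]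
  rw [Real.norm_eq_abs]
  have := abs_sub_abs_le_abs_sub (u p.1 * K₂ p.1 p.2 * v p.2) (s * (u p.1 * K₁ p.1 p.2 * v p.2))
  rw [h2] at this
  nlinarith

/-- ★ **Bilinear comparison** (the OFF-DIAGONAL size `b` of the package): if `|K₂ − sK₁| ≤ ηsK₁` pointwise, `K₁ ≥ 0` symmetric with rows `≤ M₁` (`M₁ ≥ 0`),
then for `u, v` with `u², v²` integrable (and `|u|K₁|v|` product-integrable):
`|∫∫ u K₂ v − s ∫∫ u K₁ v| ≤ η·s·M₁·‖u‖₂‖v‖₂`. [cite: Helffer2013, Lemma 7.1 (7.1.3)] -/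
theorem abs_bilin_sub_le_of_kernel_near {K₁ K₂ : X → X → ℝ} {s η M₁ : ℝ} (hs : 0 ≤ s) (hη : 0 ≤ η) (hM₁ : 0 ≤ M₁) (hK₁ : ∀ x y, 0 ≤ K₁ x y)
    (hsymm : ∀ x y, K₁ x y = K₁ y x) (hrow : ∀ᵐ x ∂μ, ∫ y, K₁ x y ∂μ ≤ M₁)
    (hnear : ∀ x y, |K₂ x y - s * K₁ x y| ≤ η * s * K₁ x y) {u v : X → ℝ} (hu : Integrable (fun x => u x ^ 2) μ)
    (hv : Integrable (fun x => v x ^ 2) μ)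
    (hmeas : AEStronglyMeasurable (fun p : X × X => u p.1 * K₂ p.1 p.2 * v p.2) (μ.prod μ))
    (hI : Integrable (fun p : X × X => |u p.1| * K₁ p.1 p.2 * |v p.2|) (μ.prod μ))
    (hIs : Integrable (fun p : X × X => u p.1 * K₁ p.1 p.2 * v p.2) (μ.prod μ))
    (hI₁ : Integrable (fun p : X × X => K₁ p.1 p.2 * u p.1 ^ 2) (μ.prod μ))
    (hI₂ : Integrable (fun p : X × X => K₁ p.1 p.2 * v p.2 ^ 2) (μ.prod μ)) :
    |(∫ x, ∫ y, u x * K₂ x y * v y ∂μ ∂μ) - s * ∫ x, ∫ y, u x * K₁ x y * v y ∂μ ∂μ| ≤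
      η * s * M₁ * (Real.sqrt (∫ x, u x ^ 2 ∂μ) * Real.sqrt (∫ x, v x ^ 2 ∂μ)) := by
  have hI2 := integrable_bilin_kernel_of_near hs hK₁ hnear hmeas hI
  rw [← integral_prod _ hI2, ← integral_prod _ hIs, ← integral_const_mul, ← integral_sub hI2 (hIs.const_mul s)]
  have hpt : ∀ p : X × X, ‖u p.1 * K₂ p.1 p.2 * v p.2 - s * (u p.1 * K₁ p.1 p.2 * v p.2)‖ ≤ η * s * (|u p.1| * K₁ p.1 p.2 * |v p.2|) := fun p => by
    rw [Real.norm_eq_abs]; exact abs_mul_sub_mul_le₂ hnear u v p.1 p.2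
  rw [← Real.norm_eq_abs]
  refine (norm_integral_le_of_norm_le (hI.const_mul (η * s)) (ae_of_all _ hpt)).trans ?_
  rw [integral_const_mul, integral_prod _ hI]
  have hgoal : ∫ x, ∫ y, |u x| * K₁ x y * |v y| ∂μ ∂μ ≤ M₁ * (Real.sqrt (∫ x, u x ^ 2 ∂μ) * Real.sqrt (∫ x, v x ^ 2 ∂μ)) := ?_
  · have := mul_le_mul_of_nonneg_left hgoal (mul_nonneg hη hs)
    simpa [mul_assoc] using this
  have hu' : Integrable (fun x => |u x| ^ 2) μ := hu.congr (ae_of_all _ fun x => (sq_abs (u x)).symm)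
  have hv' : Integrable (fun x => |v x| ^ 2) μ := hv.congr (ae_of_all _ fun x => (sq_abs (v x)).symm)
  have hcol : ∀ᵐ y ∂μ, ∫ x, K₁ x y ∂μ ≤ M₁ := by
    filter_upwards [hrow] with y hy; simpa only [hsymm] using hy
  have h := SchurTest.integral_integral_mul_kernel_mul_le_sqrt (μ := μ) (ν := μ) K₁ (fun x => |u x|) (fun y => |v y|) hM₁ hM₁ hK₁ hrow hcol hu' hv' hI
    (hI₁.congr (ae_of_all _ fun p => by simp only [sq_abs])) (hI₂.congr (ae_of_all _ fun p => by simp only [sq_abs]))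
  simp only [sq_abs] at h
  refine h.trans (le_of_eq ?_)
  rw [Real.sqrt_mul_self hM₁, Real.sqrt_mul (integral_nonneg fun x => sq_nonneg _)]

end Summit.QuantumFields.YangMills.Theorems.FemtoTransferGap.KernelComparison
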